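import Mathlib
import Summits.CriticalPhenomena.Ising3DConformalLimit.Theorems.PrecisionLaplacianInverseMFerromagnetImOfImDeg3
import HarnessLib

/-!
# Crux `PrecisionLaplacian.InverseMFerromagnet` (stmt-CriticalPhenomena-4798), line `Sketch` —
# stub `helper_sp_relabel` (T-SP·4, the relabelling step of the series–parallel induction)

THEOREM-ONLY helper file (no definitions).  DB♯ — the dressed edge bound
`(Σ⁻¹)_xy ≤ −t/(1 + t² − 2 t G_xy)` with `t = tanh (total coupling on {x,y})`,
`G_xy = ⟨σ_xσ_y⟩` — for ALL couplings on a structure `(n, m, C)` is invariant under a permutation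
`eV` of the sites and a permutation `eι` of the bonds (`C' i = eV '' C (eι i)`).  With
`K j := K' (eι⁻¹ j)` the relabelling invariance of `gksExpect` (`c5_gksExpect_relabel`) gives
`Σ' = Σ.submatrix eV⁻¹ eV⁻¹`, hence `Σ'⁻¹ = Σ⁻¹.submatrix eV⁻¹ eV⁻¹` and `G'_xy = G_{eV⁻¹x, eV⁻¹y}`;
the coupling sum over `{i : C' i = {x,y}}` is the coupling sum over `{j : C j = {eV⁻¹x, eV⁻¹y}}`
(reindex by `eι`, `Finset.map_inj`), and the hypothesis at `K` and the pair `(eV⁻¹x, eV⁻¹y)` is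
the claim.
-/

namespace Summit.CriticalPhenomena.Ising3DConformalLimit.Cruxes.InverseMFerromagnet.PartialCovarianceLadder

open Literature.Probability.LatticeModels Finset Matrix

noncomputable section

/-- Relabelled observables: for `K j = K' (eι⁻¹ j)` and `C' i = eV '' C (eι i)`,
`⟨F(ω ∘ eV)⟩_{K',C'} = ⟨F⟩_{K,C}` (`c5_gksExpect_relabel` with the bond equivalence `eι⁻¹`).
[folklore] -/
theorem spRelabel_gksExpect {n m : ℕ} (C : Fin m → Finset (Fin n)) (eV : Equiv.Perm (Fin n))
    (eι : Equiv.Perm (Fin m)) (C' : Fin m → Finset (Fin n))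
    (hC' : ∀ i, C' i = (C (eι i)).map eV.toEmbedding) (K' : Fin m → ℝ)
    (F : SpinConfig (Fin n) → ℝ) :
    gksExpect Finset.univ K' C' (fun ω' => F (fun p => ω' (eV p)))
      = gksExpect Finset.univ (fun j => K' (eι.symm j)) C F := by
  have hK : (fun j => (fun j => K' (eι.symm j)) (eι.symm.symm j)) = K' := by
    funext j
    simp
  have hC : (fun j => (C (eι.symm.symm j)).map eV.toEmbedding) = C' := by
    funext j
    rw [hC' j, Equiv.symm_symm]
  rw [← c5_gksExpect_relabel eV eι.symm (fun j => K' (eι.symm j)) C F, hK, hC]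

/-- The relabelled second-moment matrix is the `eV⁻¹`-reindexed original one:
`Σ'_{p q} = Σ_{eV⁻¹ p, eV⁻¹ q}`. [folklore] -/
theorem spRelabel_matrix {n m : ℕ} (C : Fin m → Finset (Fin n)) (eV : Equiv.Perm (Fin n))
    (eι : Equiv.Perm (Fin m)) (C' : Fin m → Finset (Fin n))
    (hC' : ∀ i, C' i = (C (eι i)).map eV.toEmbedding) (K' : Fin m → ℝ) :
    (Matrix.of fun p q : Fin n => gksExpect Finset.univ K' C' (fun ω => spinAt p ω * spinAt q ω))
      = (Matrix.of fun p q : Fin n =>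
          gksExpect Finset.univ (fun j => K' (eι.symm j)) C
            (fun ω => spinAt p ω * spinAt q ω)).submatrix eV.symm eV.symm := by
  ext p' q'
  simp only [Matrix.submatrix_apply, Matrix.of_apply]
  rw [← spRelabel_gksExpect C eV eι C' hC' K']
  congr 1
  funext ω
  simp [spinAt]

/-- A bond is mapped onto the pair `{x, y}` by the site permutation iff it is the pair
`{eV⁻¹ x, eV⁻¹ y}`. [folklore] -/
theorem spRelabel_map_eq_pair {n : ℕ} (eV : Equiv.Perm (Fin n)) (s : Finset (Fin n))
    (x y : Fin n) :
    s.map eV.toEmbedding = {x, y} ↔ s = {eV.symm x, eV.symm y} := by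
  have h : ({eV.symm x, eV.symm y} : Finset (Fin n)).map eV.toEmbedding = {x, y} := by
    rw [Finset.map_insert, Finset.map_singleton]
    simp
  rw [← h, Finset.map_inj]

/-- The total coupling of the relabelled system on `{x, y}` is the total coupling of the original
system (couplings `K j = K' (eι⁻¹ j)`) on `{eV⁻¹ x, eV⁻¹ y}`. [folklore] -/
theorem spRelabel_coupling {n m : ℕ} (C : Fin m → Finset (Fin n)) (eV : Equiv.Perm (Fin n))
    (eι : Equiv.Perm (Fin m)) (C' : Fin m → Finset (Fin n))
    (hC' : ∀ i, C' i = (C (eι i)).map eV.toEmbedding) (K' : Fin m → ℝ) (x y : Fin n) :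
    ∑ i ∈ Finset.univ.filter (fun i => C' i = {x, y}), K' i
      = ∑ j ∈ Finset.univ.filter (fun j => C j = {eV.symm x, eV.symm y}), K' (eι.symm j) := by
  refine Finset.sum_equiv eι (fun i => ?_) (fun i _ => by simp)
  simp only [Finset.mem_filter, Finset.mem_univ, true_and, hC' i, spRelabel_map_eq_pair]

/-- **T-SP·4 (relabelling).**  DB♯ for all couplings is invariant under permuting sites and bonds
(`c5_gksExpect_relabel`; the coupling sum over `{i : C' i = {x,y}}` is reindexed by the bond
permutation and `Finset.map_eq` of the site permutation). [folklore] -/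
theorem helper_sp_relabel :
    ∀ (n m : ℕ) (C : Fin m → Finset (Fin n)), (∀ i, (C i).card = 2) →
    (∀ (K : Fin m → ℝ), (∀ i, 0 ≤ K i) → ∀ x y : Fin n, x ≠ y →
        (Matrix.of fun p q : Fin n => gksExpect Finset.univ K C (fun ω => spinAt p ω * spinAt q ω))⁻¹ x y ≤
          -(Real.tanh (∑ i ∈ Finset.univ.filter (fun i => C i = {x, y}), K i)) /
            (1 + Real.tanh (∑ i ∈ Finset.univ.filter (fun i => C i = {x, y}), K i) ^ 2
              - 2 * Real.tanh (∑ i ∈ Finset.univ.filter (fun i => C i = {x, y}), K i)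
                * gksExpect Finset.univ K C (fun ω => spinAt x ω * spinAt y ω))) →
    ∀ (eV : Equiv.Perm (Fin n)) (eι : Equiv.Perm (Fin m)) (C' : Fin m → Finset (Fin n)),
      (∀ i, C' i = (C (eι i)).map eV.toEmbedding) →
      ∀ (K' : Fin m → ℝ), (∀ i, 0 ≤ K' i) → ∀ x y : Fin n, x ≠ y →
        (Matrix.of fun p q : Fin n => gksExpect Finset.univ K' C' (fun ω => spinAt p ω * spinAt q ω))⁻¹ x y ≤
          -(Real.tanh (∑ i ∈ Finset.univ.filter (fun i => C' i = {x, y}), K' i)) /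
            (1 + Real.tanh (∑ i ∈ Finset.univ.filter (fun i => C' i = {x, y}), K' i) ^ 2
              - 2 * Real.tanh (∑ i ∈ Finset.univ.filter (fun i => C' i = {x, y}), K' i)
                * gksExpect Finset.univ K' C' (fun ω => spinAt x ω * spinAt y ω)) := by
  intro n m C _hC H eV eι C' hC' K' hK' x y hxy
  -- the matrix, its inverse entry and the correlation `G'_xy` in terms of the original system
  have hmat := spRelabel_matrix C eV eι C' hC' K'
  have hG : gksExpect Finset.univ K' C' (fun ω => spinAt x ω * spinAt y ω)
      = gksExpect Finset.univ (fun j => K' (eι.symm j)) C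
          (fun ω => spinAt (eV.symm x) ω * spinAt (eV.symm y) ω) := by
    have h := congrFun (congrFun hmat x) y
    simpa only [Matrix.submatrix_apply, Matrix.of_apply] using h
  rw [hmat, Matrix.inv_submatrix_equiv, Matrix.submatrix_apply, hG,
    spRelabel_coupling C eV eι C' hC' K' x y]
  exact H (fun j => K' (eι.symm j)) (fun j => hK' _) (eV.symm x) (eV.symm y)
    (eV.symm.injective.ne hxy)

end

end Summit.CriticalPhenomena.Ising3DConformalLimit.Cruxes.InverseMFerromagnet.PartialCovarianceLadder
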